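import Summits.Ventures.PercRepro.C026Pairing
import Summits.Ventures.PercRepro.C026PendantA

/-!
# The pendant reductions for C-026 — counting over the star and the reductions

Continuation of `C026PendantA.lean` (split for the ≤ 400-line lint; proofs byte-identical): the sections «Counting
over the star» (`pendant_counts`, `pendant_reduction`) and «A pendant vertex that is not a mark» (`scaling_reduction`).
-/

namespace PercRepro

open Finset

namespace MultiGraph

section Pendant

variable {V E : Type*} (G : MultiGraph V E)

/-! ### Counting over the star -/

section Counting

variable [Fintype E] [DecidableEq E]

open Classical in
/-- The star at `c` as a type. -/
abbrev Star (c : V) : Type _ := {x : E // x ∈ G.edgesAt ({c} : Set V)}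

open Classical in
/-- The edges away from `c` as a type. -/
abbrev Rest (c : V) : Type _ := {x : E // x ∉ G.edgesAt ({c} : Set V)}

open Classical in
/-- A configuration is its star part and its rest part. -/
noncomputable def starSplit (c : V) : Config E ≃ (G.Star c → Bool) × (G.Rest c → Bool) :=
  Equiv.piEquivPiSubtypeProd (fun x => x ∈ G.edgesAt ({c} : Set V)) (fun _ => Bool)

omit [Fintype E] [DecidableEq E] in
open Classical in
/-- The inverse of the split on a star edge. -/
theorem starSplit_symm_apply_of_mem (c : V) (σ : G.Star c → Bool) (ρ : G.Rest c → Bool) {e : E}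
    (he : e ∈ G.edgesAt ({c} : Set V)) : (G.starSplit c).symm (σ, ρ) e = σ ⟨e, he⟩ := by
  simp [starSplit, Equiv.piEquivPiSubtypeProd, he]

omit [Fintype E] [DecidableEq E] in
open Classical in
/-- The inverse of the split away from the star. -/
theorem starSplit_symm_apply_of_notMem (c : V) (σ : G.Star c → Bool) (ρ : G.Rest c → Bool) {e : E}
    (he : e ∉ G.edgesAt ({c} : Set V)) : (G.starSplit c).symm (σ, ρ) e = ρ ⟨e, he⟩ := by
  simp [starSplit, Equiv.piEquivPiSubtypeProd, he]

omit [Fintype E] [DecidableEq E] in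
open Classical in
/-- `S ∖ E_c` of a split configuration: the star part becomes `⊥`. -/
theorem closeStar_starSplit_symm (c : V) (σ : G.Star c → Bool) (ρ : G.Rest c → Bool) :
    G.closeStar c ((G.starSplit c).symm (σ, ρ)) = (G.starSplit c).symm (fun _ => false, ρ) := by
  funext e
  by_cases he : e ∈ G.edgesAt ({c} : Set V)
  · rw [G.closeStar_apply_of_mem he, G.starSplit_symm_apply_of_mem c _ _ he]
  · rw [G.closeStar_apply_of_notMem he, G.starSplit_symm_apply_of_notMem c _ _ he,
      G.starSplit_symm_apply_of_notMem c _ _ he]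

omit [Fintype E] [DecidableEq E] in
open Classical in
/-- The star is open iff the star part is `⊤`. -/
theorem starOpen_starSplit_symm_iff (c : V) (σ : G.Star c → Bool) (ρ : G.Rest c → Bool) :
    G.StarOpen c ((G.starSplit c).symm (σ, ρ)) ↔ σ = fun _ => true := by
  constructor
  · intro h
    funext x
    have := h x.1 x.2
    rwa [G.starSplit_symm_apply_of_mem c _ _ x.2] at this
  · intro h e he
    rw [G.starSplit_symm_apply_of_mem c _ _ he, h]

omit [Fintype E] [DecidableEq E] in
open Classical in
/-- The star is closed iff the star part is `⊥`. -/
theorem starClosed_starSplit_symm_iff (c : V) (σ : G.Star c → Bool) (ρ : G.Rest c → Bool) :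
    G.StarClosed c ((G.starSplit c).symm (σ, ρ)) ↔ σ = fun _ => false := by
  constructor
  · intro h
    funext x
    have := h x.1 x.2
    rwa [G.starSplit_symm_apply_of_mem c _ _ x.2] at this
  · intro h e he
    rw [G.starSplit_symm_apply_of_mem c _ _ he, h]

omit G in
/-- The inner sum over the star part, left side: `Σ_σ [x ∧ (σ = t ∨ y)] = [x]·(1 + (N − 1)·[y])`. -/
theorem sum_star_lhs {α : Type*} [Fintype α] [DecidableEq α] (t : α) (x y : Prop) [Decidable x]
    [Decidable y] :
    (∑ σ : α, if x ∧ (σ = t ∨ y) then 1 else 0) =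
      (if x then 1 else 0) * (1 + (Fintype.card α - 1) * if y then 1 else 0) := by
  by_cases hx : x <;> by_cases hy : y <;> simp [hx, hy, Finset.sum_ite_eq', Finset.card_univ]
  have h1 : 1 ≤ Fintype.card α := Fintype.card_pos_iff.mpr ⟨t⟩
  omega

omit G in
/-- `Σ_σ [σ ≠ t] = N − 1`. -/
theorem sum_ite_ne {α : Type*} [Fintype α] [DecidableEq α] (t : α) :
    (∑ σ : α, if σ = t then 0 else 1) = Fintype.card α - 1 := by
  rw [Finset.sum_ite, Finset.sum_const_zero, zero_add, Finset.sum_const, smul_eq_mul, mul_one]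
  have : (Finset.univ.filter fun σ : α => ¬ σ = t) = Finset.univ.erase t := by
    ext σ
    simp [Finset.mem_erase]
  rw [this, Finset.card_erase_of_mem (Finset.mem_univ t), Finset.card_univ]

omit G in
/-- The inner sum over the star part, right side: `Σ_σ [(σ = t ∧ x) ∨ (σ ≠ t ∧ z)] = [x] + (N − 1)·[z]`. -/
theorem sum_star_rhs {α : Type*} [Fintype α] [DecidableEq α] (t : α) (x z : Prop) [Decidable x]
    [Decidable z] :
    (∑ σ : α, if (σ = t ∧ x) ∨ (σ ≠ t ∧ z) then 1 else 0) =
      (if x then 1 else 0) + (Fintype.card α - 1) * if z then 1 else 0 := by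
  have h1 : 1 ≤ Fintype.card α := Fintype.card_pos_iff.mpr ⟨t⟩
  by_cases hx : x <;> by_cases hz : z
  · have : ∀ σ : α, ((σ = t ∧ x) ∨ (σ ≠ t ∧ z)) ↔ True := fun σ => by
      constructor
      · intro _; trivial
      · intro _; by_cases h : σ = t
        · exact Or.inl ⟨h, hx⟩
        · exact Or.inr ⟨h, hz⟩
    simp only [this, if_true, Finset.sum_const, Finset.card_univ, smul_eq_mul, mul_one, if_pos hx,
      if_pos hz]
    omega
  · have : ∀ σ : α, ((σ = t ∧ x) ∨ (σ ≠ t ∧ z)) ↔ σ = t := fun σ => by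
      constructor
      · rintro (⟨h, _⟩ | ⟨_, h⟩)
        · exact h
        · exact absurd h hz
      · intro h; exact Or.inl ⟨h, hx⟩
    simp only [this, Finset.sum_ite_eq', Finset.mem_univ, if_true, if_pos hx, if_neg hz, mul_zero,
      add_zero]
  · have : ∀ σ : α, ((σ = t ∧ x) ∨ (σ ≠ t ∧ z)) ↔ ¬ σ = t := fun σ => by
      constructor
      · rintro (⟨_, h⟩ | ⟨h, _⟩)
        · exact absurd h hx
        · exact h
      · intro h; exact Or.inr ⟨h, hz⟩
    simp only [this, if_neg hx, if_pos hz, mul_one, zero_add]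
    have e : ∀ σ : α, (if ¬ σ = t then 1 else 0) = if σ = t then 0 else 1 := fun σ => by
      by_cases h : σ = t <;> simp [h]
    simp only [e, sum_ite_ne]
  · have : ∀ σ : α, ((σ = t ∧ x) ∨ (σ ≠ t ∧ z)) ↔ False := fun σ => by
      constructor
      · rintro (⟨_, h⟩ | ⟨_, h⟩)
        · exact hx h
        · exact hz h
      · intro h; exact h.elim
    simp only [this, if_false, Finset.sum_const_zero, if_neg hx, if_neg hz, mul_zero, add_zero]

omit G in
/-- The inner sum over the star part, star closed: `Σ_σ [σ = t ∧ x] = [x]`. -/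
theorem sum_star_closed {α : Type*} [Fintype α] [DecidableEq α] (t : α) (x : Prop) [Decidable x] :
    (∑ σ : α, if σ = t ∧ x then 1 else 0) = if x then 1 else 0 := by
  by_cases hx : x <;> simp [hx, Finset.sum_ite_eq']

open Classical in
/-- A count over configurations as a double sum over the split (instance-generic in `P`). -/
theorem card_filter_eq_sum_split (c : V) (P : Config E → Prop) [DecidablePred P] :
    (Finset.univ.filter fun S : Config E => P S).card =
      ∑ ρ : G.Rest c → Bool, ∑ σ : G.Star c → Bool,
        if P ((G.starSplit c).symm (σ, ρ)) then 1 else 0 := by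
  rw [Finset.card_filter]
  rw [Fintype.sum_equiv (G.starSplit c) (fun S => if P S then 1 else 0)
    (fun x => if P ((G.starSplit c).symm x) then 1 else 0) (fun S => by simp)]
  rw [Fintype.sum_prod_type]
  exact Finset.sum_comm

open Classical in
/-- **The pendant reduction, counted**: with `N` star configurations and `X` the star-closed
configurations with `a ~ b`, `#LHS = X + (N − 1)·A` and `#RHS = X + (N − 1)·B`. -/
theorem pendant_counts {c w : V} (hp : G.Pendant c w) (hcw : c ≠ w) {a b : V} (hac : a ≠ c)
    (hbc : b ≠ c) :
    (Finset.univ.filter fun S : Config E => G.Conn S a b ∧ G.IsCIso Sᶜ a b c).card =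
        (Finset.univ.filter fun S : Config E => G.StarClosed c S ∧ G.Conn S a b).card +
          (Fintype.card (G.Star c → Bool) - 1) *
            (Finset.univ.filter fun S : Config E =>
              G.StarClosed c S ∧ G.Conn S a b ∧ G.IsCIso Sᶜ a b w).card ∧
      (Finset.univ.filter fun S : Config E => G.OnePair S a b c).card =
        (Finset.univ.filter fun S : Config E => G.StarClosed c S ∧ G.Conn S a b).card +
          (Fintype.card (G.Star c → Bool) - 1) *
            (Finset.univ.filter fun S : Config E => G.StarClosed c S ∧ G.OnePair S a b w).card := by
  -- the four counts as double sums
  rw [G.card_filter_eq_sum_split c, G.card_filter_eq_sum_split c, G.card_filter_eq_sum_split c,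
    G.card_filter_eq_sum_split c, G.card_filter_eq_sum_split c]
  -- the inner sums
  have hL : ∀ ρ : G.Rest c → Bool, (∑ σ : G.Star c → Bool,
      if G.Conn ((G.starSplit c).symm (σ, ρ)) a b ∧ G.IsCIso ((G.starSplit c).symm (σ, ρ))ᶜ a b c
        then 1 else 0) =
      (if G.Conn ((G.starSplit c).symm (fun _ => false, ρ)) a b then 1 else 0) *
        (1 + (Fintype.card (G.Star c → Bool) - 1) *
          if G.IsCIso ((G.starSplit c).symm (fun _ => false, ρ))ᶜ a b w then 1 else 0) := by
    intro ρ
    rw [← sum_star_lhs (α := G.Star c → Bool) (fun _ => true)]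
    refine Finset.sum_congr rfl fun σ _ => ?_
    simp only [G.lhs_iff hp hcw hac hbc, G.closeStar_starSplit_symm, G.starOpen_starSplit_symm_iff]
  have hR : ∀ ρ : G.Rest c → Bool, (∑ σ : G.Star c → Bool,
      if G.OnePair ((G.starSplit c).symm (σ, ρ)) a b c then 1 else 0) =
      (if G.Conn ((G.starSplit c).symm (fun _ => false, ρ)) a b then 1 else 0) +
        (Fintype.card (G.Star c → Bool) - 1) *
          if G.OnePair ((G.starSplit c).symm (fun _ => false, ρ)) a b w then 1 else 0 := by
    intro ρ
    rw [← sum_star_rhs (α := G.Star c → Bool) (fun _ => false)]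
    refine Finset.sum_congr rfl fun σ _ => ?_
    simp only [G.rhs_iff hp hcw hac hbc, G.closeStar_starSplit_symm, G.starClosed_starSplit_symm_iff]
  have hX : ∀ ρ : G.Rest c → Bool, (∑ σ : G.Star c → Bool,
      if G.StarClosed c ((G.starSplit c).symm (σ, ρ)) ∧ G.Conn ((G.starSplit c).symm (σ, ρ)) a b
        then 1 else 0) =
      if G.Conn ((G.starSplit c).symm (fun _ => false, ρ)) a b then 1 else 0 := by
    intro ρ
    rw [← sum_star_closed (α := G.Star c → Bool) (fun _ => false)]
    refine Finset.sum_congr rfl fun σ _ => ?_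
    simp only [G.starClosed_starSplit_symm_iff]
    by_cases hσ : σ = fun _ => false
    · subst hσ
      simp
    · simp [hσ]
  have hA : ∀ ρ : G.Rest c → Bool, (∑ σ : G.Star c → Bool,
      if G.StarClosed c ((G.starSplit c).symm (σ, ρ)) ∧ G.Conn ((G.starSplit c).symm (σ, ρ)) a b ∧
        G.IsCIso ((G.starSplit c).symm (σ, ρ))ᶜ a b w then 1 else 0) =
      if G.Conn ((G.starSplit c).symm (fun _ => false, ρ)) a b ∧
        G.IsCIso ((G.starSplit c).symm (fun _ => false, ρ))ᶜ a b w then 1 else 0 := by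
    intro ρ
    rw [← sum_star_closed (α := G.Star c → Bool) (fun _ => false)]
    refine Finset.sum_congr rfl fun σ _ => ?_
    simp only [G.starClosed_starSplit_symm_iff]
    by_cases hσ : σ = fun _ => false
    · subst hσ
      simp
    · simp [hσ]
  have hB : ∀ ρ : G.Rest c → Bool, (∑ σ : G.Star c → Bool,
      if G.StarClosed c ((G.starSplit c).symm (σ, ρ)) ∧
        G.OnePair ((G.starSplit c).symm (σ, ρ)) a b w then 1 else 0) =
      if G.OnePair ((G.starSplit c).symm (fun _ => false, ρ)) a b w then 1 else 0 := by
    intro ρ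
    rw [← sum_star_closed (α := G.Star c → Bool) (fun _ => false)]
    refine Finset.sum_congr rfl fun σ _ => ?_
    simp only [G.starClosed_starSplit_symm_iff]
    by_cases hσ : σ = fun _ => false
    · subst hσ
      simp
    · simp [hσ]
  simp only [hL, hR, hX, hA, hB]
  constructor
  · rw [Finset.mul_sum, ← Finset.sum_add_distrib]
    refine Finset.sum_congr rfl fun ρ _ => ?_
    by_cases h1 : G.Conn ((G.starSplit c).symm (fun _ => false, ρ)) a b <;>
      by_cases h2 : G.IsCIso ((G.starSplit c).symm (fun _ => false, ρ))ᶜ a b w <;> simp [h1, h2]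
  · rw [Finset.mul_sum, ← Finset.sum_add_distrib]

open Classical in
/-- **The pendant reduction** (mine-3 §8 / §11 S4): for `c` pendant at `w`, the class lemma of
`(a, b, c)` on `G` is the class lemma of `(a, b, w)` on the star-closed configurations (= on `G − c`). -/
theorem pendant_reduction {c w : V} (hp : G.Pendant c w) (hcw : c ≠ w) {a b : V} (hac : a ≠ c)
    (hbc : b ≠ c) :
    ((Finset.univ.filter fun S : Config E => G.Conn S a b ∧ G.IsCIso Sᶜ a b c).card ≤
        (Finset.univ.filter fun S : Config E => G.OnePair S a b c).card) ↔
      ((Finset.univ.filter fun S : Config E =>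
          G.StarClosed c S ∧ G.Conn S a b ∧ G.IsCIso Sᶜ a b w).card ≤
        (Finset.univ.filter fun S : Config E => G.StarClosed c S ∧ G.OnePair S a b w).card) := by
  obtain ⟨hL, hR⟩ := G.pendant_counts hp hcw hac hbc
  -- the star is nonempty, so `N ≥ 2`
  have hN : 2 ≤ Fintype.card (G.Star c → Bool) := by
    obtain ⟨e, he⟩ := hp.2
    have : (fun _ : G.Star c => false) ≠ fun _ => true := by
      intro h
      have := congrFun h ⟨e, he⟩
      simp at this
    exact Fintype.one_lt_card_iff.mpr ⟨_, _, this⟩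
  rw [hL, hR]
  set N := Fintype.card (G.Star c → Bool) with hNdef
  set X := (Finset.univ.filter fun S : Config E => G.StarClosed c S ∧ G.Conn S a b).card with hXdef
  set A := (Finset.univ.filter fun S : Config E =>
    G.StarClosed c S ∧ G.Conn S a b ∧ G.IsCIso Sᶜ a b w).card with hAdef
  set B := (Finset.univ.filter fun S : Config E => G.StarClosed c S ∧ G.OnePair S a b w).card
    with hBdef
  have hpos : 0 < N - 1 := by omega
  constructor
  · intro h
    have h' : (N - 1) * A ≤ (N - 1) * B := by omega
    exact Nat.le_of_mul_le_mul_left h' hpos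
  · intro h
    have := Nat.mul_le_mul_left (N - 1) h
    omega

end Counting


/-! ### A pendant vertex that is not a mark: both sides scale by `N` -/

omit G in
/-- `Σ_σ [x] = N·[x]`. -/
theorem sum_star_const {α : Type*} [Fintype α] (x : Prop) [Decidable x] :
    (∑ _σ : α, if x then (1 : ℕ) else 0) = Fintype.card α * if x then 1 else 0 := by
  rw [Finset.sum_const, Finset.card_univ, smul_eq_mul]

/-- **Connectivity among three vertices away from a pendant `v` ignores its star** (the complement
too). -/
theorem cells_closeStar_of_pendant {v w : V} (hp : G.Pendant v w) (hvw : v ≠ w) {a b c : V}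
    (hav : a ≠ v) (hbv : b ≠ v) (hcv : c ≠ v) (S : Config E) :
    ((G.Conn S a b ∧ G.IsCIso Sᶜ a b c) ↔
        (G.Conn (G.closeStar v S) a b ∧ G.IsCIso (G.closeStar v S)ᶜ a b c)) ∧
      (G.OnePair S a b c ↔ G.OnePair (G.closeStar v S) a b c) := by
  have key : ∀ (T : Config E) (x y : V), x ≠ v → y ≠ v →
      (G.Conn Tᶜ x y ↔ G.Conn (G.closeStar v T)ᶜ x y) := by
    intro T x y hx hy
    rw [G.conn_closeStar_iff hp hvw hx hy, G.closeStar_compl_closeStar,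
      ← G.conn_closeStar_iff hp hvw (S := (G.closeStar v T)ᶜ) hx hy]
  constructor
  · rw [G.conn_closeStar_iff hp hvw hav hbv]
    unfold IsCIso
    rw [key S a c hav hcv, key S b c hbv hcv]
  · unfold OnePair
    rw [G.conn_closeStar_iff hp hvw hav hbv, G.conn_closeStar_iff hp hvw hav hcv,
      G.conn_closeStar_iff hp hvw hbv hcv]

variable [Fintype E] [DecidableEq E]

open Classical in
/-- **The scaling reduction**: for a pendant vertex `v` that is not a mark, both counts are `N` times
their star-closed versions, so `(CF)_G(a, b, c) ⟺ (CF)` on the star-closed configurations. -/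
theorem scaling_reduction {v w : V} (hp : G.Pendant v w) (hvw : v ≠ w) {a b c : V} (hav : a ≠ v)
    (hbv : b ≠ v) (hcv : c ≠ v) :
    ((Finset.univ.filter fun S : Config E => G.Conn S a b ∧ G.IsCIso Sᶜ a b c).card ≤
        (Finset.univ.filter fun S : Config E => G.OnePair S a b c).card) ↔
      ((Finset.univ.filter fun S : Config E =>
          G.StarClosed v S ∧ G.Conn S a b ∧ G.IsCIso Sᶜ a b c).card ≤
        (Finset.univ.filter fun S : Config E => G.StarClosed v S ∧ G.OnePair S a b c).card) := by
  have hN : 0 < Fintype.card (G.Star v → Bool) := Fintype.card_pos_iff.mpr ⟨fun _ => false⟩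
  have hL : (Finset.univ.filter fun S : Config E => G.Conn S a b ∧ G.IsCIso Sᶜ a b c).card =
      Fintype.card (G.Star v → Bool) * (Finset.univ.filter fun S : Config E =>
        G.StarClosed v S ∧ G.Conn S a b ∧ G.IsCIso Sᶜ a b c).card := by
    rw [G.card_filter_eq_sum_split v, G.card_filter_eq_sum_split v, Finset.mul_sum]
    refine Finset.sum_congr rfl fun ρ _ => ?_
    have e1 : ∀ σ : G.Star v → Bool,
        (G.Conn ((G.starSplit v).symm (σ, ρ)) a b ∧ G.IsCIso ((G.starSplit v).symm (σ, ρ))ᶜ a b c) ↔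
        (G.Conn ((G.starSplit v).symm (fun _ => false, ρ)) a b ∧
          G.IsCIso ((G.starSplit v).symm (fun _ => false, ρ))ᶜ a b c) := fun σ => by
      rw [(G.cells_closeStar_of_pendant hp hvw hav hbv hcv _).1, G.closeStar_starSplit_symm]
    simp only [e1, sum_star_const]
    rw [← sum_star_closed (α := G.Star v → Bool) (fun _ => false)]
    congr 1
    refine Finset.sum_congr rfl fun σ _ => ?_
    rw [G.starClosed_starSplit_symm_iff]
    split_ifs <;> rfl
  have hR : (Finset.univ.filter fun S : Config E => G.OnePair S a b c).card =
      Fintype.card (G.Star v → Bool) * (Finset.univ.filter fun S : Config E =>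
        G.StarClosed v S ∧ G.OnePair S a b c).card := by
    rw [G.card_filter_eq_sum_split v, G.card_filter_eq_sum_split v, Finset.mul_sum]
    refine Finset.sum_congr rfl fun ρ _ => ?_
    have e1 : ∀ σ : G.Star v → Bool,
        G.OnePair ((G.starSplit v).symm (σ, ρ)) a b c ↔
          G.OnePair ((G.starSplit v).symm (fun _ => false, ρ)) a b c := fun σ => by
      rw [(G.cells_closeStar_of_pendant hp hvw hav hbv hcv _).2, G.closeStar_starSplit_symm]
    simp only [e1, sum_star_const]
    rw [← sum_star_closed (α := G.Star v → Bool) (fun _ => false)]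
    congr 1
    refine Finset.sum_congr rfl fun σ _ => ?_
    rw [G.starClosed_starSplit_symm_iff]
    split_ifs <;> rfl
  rw [hL, hR]
  constructor
  · intro h
    exact Nat.le_of_mul_le_mul_left h hN
  · intro h
    exact Nat.mul_le_mul_left _ h

end Pendant

end MultiGraph

end PercRepro
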